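/-
Copyright (c) 2026. All rights reserved.
Released under Apache 2.0 license as described in the file LICENSE.
-/
import Mathlib
import Summits.RiemannHypothesis.RiemannHypothesis.Theorems.HandoffLatticeTailDepth
import HarnessLib

/-!
# The ζ-side identities of the lattice tail for Lipschitz data: L-M3 (zero forcing), L-M2 (Plancherel split)

`HANDOFF/prove-1` gen15, ATTEMPT-22 §3 / idea-1's hand-off package (IDEAS-prolate §131.3,
g24/lean/HandoffZetaSidePackage.lean: `tailTransform_eq_neg_windowTransform_of_zeta_zero`,
`latticeTail_eq_integral_zetaSide`), stated over the TREE's objects without new definitions: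
`θ_tail = 1_{(0,1/λ]}·θ_F`, `θ_win = 1_{(1/λ,∞)}·θ_F` (`θ_F = dilationSum λ F`), their Mellin
transforms on `Re s = 1/2` being idea-1's `tailTransform` / `windowTransform`.

* `mellin_dilationSum_eq_tail_add_window` — `𝓜θ_F = 𝓜θ_tail + 𝓜θ_win` on `Re s > 0`;
* `mellin_tail_eq_neg_mellin_window_of_zeta_zero` — **L-M3**: at a critical zero,
  `𝓜θ_tail(½+iγ) = −𝓜θ_win(½+iγ)` (Müntz, tree (2.11.1), file `HandoffLatticeTailDepth`);
* `latticeTail_eq_integral_zetaSide` — **L-M2**: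
  `T_λ(F) = (1/2π) ∫ ‖ζ(½+iη)𝓜F(½+iη) − 𝓜θ_win(½+iη)‖² dη` (tree Mellin–Plancherel).

Hypotheses (abstract): `F` measurable, vanishing beyond `λ ≥ 1`, `‖θ_F‖ ≤ B`, and Müntz's formula
on `Re s > 0` (both discharged for Lipschitz data in `HandoffLatticeTailDepth`, for one-jump data in
`HandoffLatticeTailJump`). RH-free identities of classical analysis; nothing here bears on RH.
-/

noncomputable section

set_option linter.dupNamespace false

open Complex MeasureTheory Set Filter
open Literature.NumberTheory.LFunctions
open scoped NNReal

namespace Summit.RiemannHypothesis.RiemannHypothesis.Theorems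

namespace LatticeUncertainty

variable {lam : ℝ} {F : ℝ → ℂ}

/-! ## The ζ-side identities L-M3 (zero forcing) and L-M2 (Plancherel split) for Lipschitz data

Notation: `θ_tail = 1_{(0,1/λ]}·θ_F` (the TAIL, below the window) and `θ_win = 1_{(1/λ,∞)}·θ_F`
(the WINDOW block); idea-1's `tailTransform`/`windowTransform` (IDEAS-prolate §131.3,
g24/lean/HandoffZetaSidePackage.lean) are their Mellin transforms on `Re s = 1/2`. -/

section ZetaSide

/-! ### Abstract hypotheses
The identities below need only: `F` measurable, vanishing beyond `λ ≥ 1`, a uniform bound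
`‖θ_F‖ ≤ B` for the dilation sum, and MÜNTZ'S FORMULA on `Re s > 0`, `s ≠ 1`. Both are supplied for
Lipschitz data by `norm_dilationSum_le_of_lipschitzOn` / `mellin_dilationSum_eq_zeta_mul`
(file `HandoffLatticeTailDepth`), and for data with one interior jump by `HandoffLatticeTailJump`. -/

variable (hlam : 1 ≤ lam) (hFm : Measurable F) {B : ℝ} (hB : ∀ u, ‖dilationSum lam F u‖ ≤ B)
  (hMuntz : ∀ s : ℂ, 0 < s.re → s ≠ 1 → mellin (dilationSum lam F) s = riemannZeta s * mellin F s)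
include hlam hFm hB

/-- The window block `θ_win` is bounded, measurable and supported in `[1/λ, λ]`; its Mellin
transform converges everywhere. -/
theorem mellinConvergent_window (s : ℂ) :
    MellinConvergent ((Ioi (1 / lam)).indicator (dilationSum lam F)) s := by
  refine mellinConvergent_of_support (a := 1 / lam) (b := lam) (Mθ := B) (by positivity)
    ((measurable_dilationSum hFm lam).indicator measurableSet_Ioi) (fun u ↦ ?_) (fun u hu ↦ ?_) s
  · have h0 : 0 ≤ B := (norm_nonneg _).trans (hB 0)
    by_cases h : u ∈ Ioi (1 / lam)
    · rw [indicator_of_mem h]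
      exact hB u
    · rw [indicator_of_notMem h, norm_zero]; exact h0
  · by_cases h : u ∈ Ioi (1 / lam)
    · rw [indicator_of_mem h]
      exact dilationSum_eq_zero_of_lt (by positivity) (not_le.mp fun h' ↦ hu ⟨le_of_lt h, h'⟩)
    · exact indicator_of_notMem h _

omit hlam in
/-- The tail `θ_tail` is bounded and vanishes beyond `1/λ`; its Mellin transform converges on
`Re s > 0`. -/
theorem mellinConvergent_tail {s : ℂ} (hs : 0 < s.re) :
    MellinConvergent ((Ioc 0 (1 / lam)).indicator (dilationSum lam F)) s := by
  have h0 : 0 ≤ B := (norm_nonneg _).trans (hB 0)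
  have hθm : Measurable ((Ioc 0 (1 / lam)).indicator (dilationSum lam F)) :=
    (measurable_dilationSum hFm lam).indicator measurableSet_Ioc
  have hθb : ∀ u, ‖(Ioc 0 (1 / lam)).indicator (dilationSum lam F) u‖ ≤ B := by
    intro u
    by_cases h : u ∈ Ioc 0 (1 / lam)
    · rw [indicator_of_mem h]; exact hB u
    · rw [indicator_of_notMem h, norm_zero]; exact h0
  have hθs : ∀ u, u ∉ Icc 0 (1 / lam) → (Ioc 0 (1 / lam)).indicator (dilationSum lam F) u = 0 :=
    fun u hu ↦ indicator_of_notMem (fun h ↦ hu (Ioc_subset_Icc_self h)) _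
  refine mellinConvergent_of_isBigO_rpow (a := s.re + 1) (b := 0)
    ((integrable_of_bdd_of_support hθm.aestronglyMeasurable hθb hθs).locallyIntegrable
      |>.locallyIntegrableOn _) ?_ (by linarith) ?_ hs
  · have hz : (Ioc 0 (1 / lam)).indicator (dilationSum lam F) =ᶠ[atTop] fun _ ↦ (0 : ℂ) := by
      filter_upwards [eventually_gt_atTop (1 / lam)] with u hu
      exact indicator_of_notMem (fun h ↦ not_le.mpr hu h.2) _
    exact (Asymptotics.isBigO_zero _ _).congr' hz.symm EventuallyEq.rfl
  · refine Asymptotics.IsBigO.of_bound B (Eventually.of_forall fun u ↦ ?_)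
    rw [neg_zero, Real.rpow_zero, norm_one, mul_one]
    exact hθb u

/-- `𝓜θ_F = 𝓜θ_tail + 𝓜θ_win` on `Re s > 0`. -/
theorem mellin_dilationSum_eq_tail_add_window {s : ℂ} (hs : 0 < s.re) :
    mellin (dilationSum lam F) s = mellin ((Ioc 0 (1 / lam)).indicator (dilationSum lam F)) s +
      mellin ((Ioi (1 / lam)).indicator (dilationSum lam F)) s := by
  have h1 := mellinConvergent_tail hFm hB hs
  have h2 := mellinConvergent_window hlam hFm hB s
  rw [mellin, mellin, mellin, ← integral_add h1 h2]
  refine setIntegral_congr_fun measurableSet_Ioi fun u hu ↦ ?_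
  rw [← smul_add]
  congr 1
  by_cases h : u ≤ 1 / lam
  · have hn : u ∉ Ioi (1 / lam) := fun h' ↦ not_lt.mpr h (mem_Ioi.mp h')
    rw [indicator_of_mem (mem_Ioc.mpr ⟨hu, h⟩), indicator_of_notMem hn, add_zero]
  · have hn : u ∉ Ioc 0 (1 / lam) := fun h' ↦ h (mem_Ioc.mp h').2
    rw [indicator_of_notMem hn, indicator_of_mem (mem_Ioi.mpr (not_le.mp h)), zero_add]

include hMuntz in
/-- **L-M3 (zero forcing).** At every critical zero `½ + iγ` of `ζ` the tail transform cancels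
the window transform: `𝓜θ_tail(½+iγ) = −𝓜θ_win(½+iγ)`. (idea-1 §131.3 L-M3.) -/
theorem mellin_tail_eq_neg_mellin_window_of_zeta_zero {γ : ℝ}
    (hγ : riemannZeta (1 / 2 + γ * I) = 0) :
    mellin ((Ioc 0 (1 / lam)).indicator (dilationSum lam F)) (1 / 2 + γ * I) =
      - mellin ((Ioi (1 / lam)).indicator (dilationSum lam F)) (1 / 2 + γ * I) := by
  have hs : 0 < (1 / 2 + γ * I : ℂ).re := by simp
  have hs1 : (1 / 2 + γ * I : ℂ) ≠ 1 := fun h ↦ by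
    have := congrArg Complex.re h
    norm_num at this
  have hμ := hMuntz _ hs hs1
  rw [hγ, zero_mul, mellin_dilationSum_eq_tail_add_window hlam hFm hB hs] at hμ
  exact eq_neg_of_add_eq_zero_left hμ

include hMuntz in
/-- **L-M2 (Plancherel split on the critical line).**
`T_λ(F) = (1/2π) ∫ ‖ζ(½+iη)·𝓜F(½+iη) − 𝓜θ_win(½+iη)‖² dη`: the lattice tail is the critical-line
energy of `ζ·𝓜F` minus the WINDOW transform (idea-1 §131.3 L-M2; tree Mellin–Plancherel
`integral_norm_sq_mellin_half_eq` + Müntz). -/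
theorem latticeTail_eq_integral_zetaSide :
    latticeTail lam F = (1 / (2 * Real.pi)) * ∫ η : ℝ,
      ‖riemannZeta (1 / 2 + η * I) * mellin F (1 / 2 + η * I)
        - mellin ((Ioi (1 / lam)).indicator (dilationSum lam F)) (1 / 2 + η * I)‖ ^ 2 := by
  set θt := (Ioc 0 (1 / lam)).indicator (dilationSum lam F) with hθt
  have h0 : 0 ≤ B := (norm_nonneg _).trans (hB 0)
  have hθm : Measurable θt := (measurable_dilationSum hFm lam).indicator measurableSet_Ioc
  have hsq : IntegrableOn (fun u ↦ ‖θt u‖ ^ 2) (Ioi 0) := by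
    refine (integrable_of_bdd_of_support (M := B ^ 2) (a := 0) (b := 1 / lam)
      (hθm.norm.pow_const 2).aestronglyMeasurable (fun u ↦ ?_) (fun u hu ↦ ?_)).integrableOn
    · rw [Real.norm_of_nonneg (by positivity)]
      refine pow_le_pow_left₀ (norm_nonneg _) ?_ 2
      by_cases h : u ∈ Ioc 0 (1 / lam)
      · rw [hθt, indicator_of_mem h]; exact hB u
      · rw [hθt, indicator_of_notMem h, norm_zero]; exact h0
    · rw [hθt, indicator_of_notMem (fun h ↦ hu (Ioc_subset_Icc_self h)), norm_zero,
        zero_pow two_ne_zero]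
  have hmc : MellinConvergent θt (1 / 2 : ℂ) :=
    mellinConvergent_tail hFm hB (by norm_num)
  have hP := (Literature.Analysis.FunctionSpaces.integral_norm_sq_mellin_half_eq hmc hsq).2
  -- `latticeTail = ∫_{(0,∞)} ‖θ_tail‖²`
  have hT : latticeTail lam F = ∫ u in Ioi 0, ‖θt u‖ ^ 2 := by
    rw [latticeTail]
    symm
    refine (setIntegral_eq_of_subset_of_forall_sdiff_eq_zero measurableSet_Ioi
      Ioc_subset_Ioi_self fun u hu ↦ ?_).trans (setIntegral_congr_fun measurableSet_Ioc
        fun u hu ↦ ?_)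
    · rw [hθt, indicator_of_notMem hu.2, norm_zero, zero_pow two_ne_zero]
    · rw [hθt, indicator_of_mem hu]
  -- the tail transform on the line, by Müntz
  have hline : ∀ η : ℝ, mellin θt (1 / 2 + η * I) =
      riemannZeta (1 / 2 + η * I) * mellin F (1 / 2 + η * I)
        - mellin ((Ioi (1 / lam)).indicator (dilationSum lam F)) (1 / 2 + η * I) := by
    intro η
    have hs : 0 < (1 / 2 + η * I : ℂ).re := by simp
    have hs1 : (1 / 2 + η * I : ℂ) ≠ 1 := fun h ↦ by
      have := congrArg Complex.re h
      norm_num at this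
    rw [eq_sub_iff_add_eq, hθt, ← mellin_dilationSum_eq_tail_add_window hlam hFm hB hs]
    exact hMuntz _ hs hs1
  simp_rw [← hline]
  rw [hP, hT]
  field_simp

end ZetaSide

end LatticeUncertainty

end Summit.RiemannHypothesis.RiemannHypothesis.Theorems
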